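import Mathlib

/-!
# Crux-triage r1-2 evidence for stmt-Parity-14271 (`DilatedTableChowla`)

Sorry-free proofs of the two "soft" linear-algebra levers used by the ideator-3 cards
`positivity-quarantine` (lever (P) = `GramFourthMomentMonotone`) and `rough-rows-descent`
(lever (P') = `RowSplitBound`), restated VERBATIM from
`Summits/Parity/GeneralizedHardyLittlewood/Cruxes/DilatedTableChowla/Sketch.lean`
(that module is not built on the farm, so it is not imported; the `Prop`s below are
character-for-character the Sketch definitions).

Key identity (`cross_eq`): the cross Gram term is a sum of squares,
`Σ_{a,a'∈S} (Σ_{b∈T} f a b f a' b)(Σ_{d∈D} f a d f a' d) = Σ_{b∈T} Σ_{d∈D} (Σ_{a∈S} f a b f a d)²`,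
i.e. `tr(G_T G_D) = ‖M_Tᵀ M_D‖_F² ≥ 0`.
-/

namespace Summit.Parity.GeneralizedHardyLittlewood.Cruxes.DilatedTableChowla.Triage2

open Finset

/-- verbatim `Sketch.GramFourthMomentMonotone` (card positivity-quarantine, lever (P)). -/
def GramFourthMomentMonotone : Prop :=
  ∀ (f : ℕ → ℕ → ℝ) (S S' T T' : Finset ℕ), S ⊆ S' → T ⊆ T' →
    (∑ a ∈ S, ∑ a' ∈ S, (∑ b ∈ T, f a b * f a' b) ^ 2) ≤
      ∑ a ∈ S', ∑ a' ∈ S', (∑ b ∈ T', f a b * f a' b) ^ 2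

/-- verbatim `Sketch.RowSplitBound` (card rough-rows-descent, lever (P')). -/
def RowSplitBound : Prop :=
  ∀ (f : ℕ → ℕ → ℝ) (S₁ S₂ T : Finset ℕ), Disjoint S₁ S₂ →
    (∑ a ∈ S₁ ∪ S₂, ∑ a' ∈ S₁ ∪ S₂, (∑ b ∈ T, f a b * f a' b) ^ 2) ≤
      2 * ((∑ a ∈ S₁, ∑ a' ∈ S₁, (∑ b ∈ T, f a b * f a' b) ^ 2) +
        (∑ a ∈ S₂, ∑ a' ∈ S₂, (∑ b ∈ T, f a b * f a' b) ^ 2))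

/-- Row monotonicity: dropping rows drops non-negative terms. -/
theorem rows_mono (f : ℕ → ℕ → ℝ) (S S' T : Finset ℕ) (hS : S ⊆ S') :
    (∑ a ∈ S, ∑ a' ∈ S, (∑ b ∈ T, f a b * f a' b) ^ 2) ≤
      ∑ a ∈ S', ∑ a' ∈ S', (∑ b ∈ T, f a b * f a' b) ^ 2 := by
  calc (∑ a ∈ S, ∑ a' ∈ S, (∑ b ∈ T, f a b * f a' b) ^ 2)
      ≤ ∑ a ∈ S, ∑ a' ∈ S', (∑ b ∈ T, f a b * f a' b) ^ 2 := by
        apply Finset.sum_le_sum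
        intro a _
        exact Finset.sum_le_sum_of_subset_of_nonneg hS (fun _ _ _ => sq_nonneg _)
    _ ≤ ∑ a ∈ S', ∑ a' ∈ S', (∑ b ∈ T, f a b * f a' b) ^ 2 :=
        Finset.sum_le_sum_of_subset_of_nonneg hS
          (fun _ _ _ => Finset.sum_nonneg (fun _ _ => sq_nonneg _))

/-- The cross Gram term between two column sets, over two (possibly different) row sets, rearranged
as a double sum over column pairs. -/
theorem cross_eq₂ (f : ℕ → ℕ → ℝ) (S₁ S₂ T D : Finset ℕ) :
    (∑ a ∈ S₁, ∑ a' ∈ S₂, (∑ b ∈ T, f a b * f a' b) * (∑ d ∈ D, f a d * f a' d)) =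
      ∑ b ∈ T, ∑ d ∈ D, (∑ a ∈ S₁, f a b * f a d) * (∑ a' ∈ S₂, f a' b * f a' d) := by
  have e1 : ∀ a a', (∑ b ∈ T, f a b * f a' b) * (∑ d ∈ D, f a d * f a' d) =
      ∑ b ∈ T, ∑ d ∈ D, (f a b * f a d) * (f a' b * f a' d) := by
    intro a a'
    rw [Finset.sum_mul_sum]
    apply Finset.sum_congr rfl
    intro b _
    apply Finset.sum_congr rfl
    intro d _
    ring
  have e2 : ∀ b d, (∑ a ∈ S₁, f a b * f a d) * (∑ a' ∈ S₂, f a' b * f a' d) =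
      ∑ a ∈ S₁, ∑ a' ∈ S₂, (f a b * f a d) * (f a' b * f a' d) := by
    intro b d
    rw [Finset.sum_mul_sum]
  simp_rw [e1, e2]
  calc ∑ a ∈ S₁, ∑ a' ∈ S₂, ∑ b ∈ T, ∑ d ∈ D, (f a b * f a d) * (f a' b * f a' d)
      = ∑ a ∈ S₁, ∑ b ∈ T, ∑ a' ∈ S₂, ∑ d ∈ D, (f a b * f a d) * (f a' b * f a' d) := by
        apply Finset.sum_congr rfl
        intro a _
        exact Finset.sum_comm
    _ = ∑ b ∈ T, ∑ a ∈ S₁, ∑ a' ∈ S₂, ∑ d ∈ D, (f a b * f a d) * (f a' b * f a' d) :=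
        Finset.sum_comm
    _ = ∑ b ∈ T, ∑ a ∈ S₁, ∑ d ∈ D, ∑ a' ∈ S₂, (f a b * f a d) * (f a' b * f a' d) := by
        apply Finset.sum_congr rfl
        intro b _
        apply Finset.sum_congr rfl
        intro a _
        exact Finset.sum_comm
    _ = ∑ b ∈ T, ∑ d ∈ D, ∑ a ∈ S₁, ∑ a' ∈ S₂, (f a b * f a d) * (f a' b * f a' d) := by
        apply Finset.sum_congr rfl
        intro b _
        exact Finset.sum_comm

/-- `tr(G_T G_D) = ‖M_Tᵀ M_D‖_F²`: the cross Gram term is a sum of squares. -/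
theorem cross_eq (f : ℕ → ℕ → ℝ) (S T D : Finset ℕ) :
    (∑ a ∈ S, ∑ a' ∈ S, (∑ b ∈ T, f a b * f a' b) * (∑ d ∈ D, f a d * f a' d)) =
      ∑ b ∈ T, ∑ d ∈ D, (∑ a ∈ S, f a b * f a d) ^ 2 := by
  rw [cross_eq₂]
  apply Finset.sum_congr rfl
  intro b _
  apply Finset.sum_congr rfl
  intro d _
  ring

theorem cross_nonneg (f : ℕ → ℕ → ℝ) (S T D : Finset ℕ) :
    0 ≤ ∑ a ∈ S, ∑ a' ∈ S, (∑ b ∈ T, f a b * f a' b) * (∑ d ∈ D, f a d * f a' d) := by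
  rw [cross_eq]
  exact Finset.sum_nonneg (fun _ _ => Finset.sum_nonneg (fun _ _ => sq_nonneg _))

theorem sq_sum_expand (S : Finset ℕ) (g h : ℕ → ℕ → ℝ) :
    (∑ a ∈ S, ∑ a' ∈ S, (g a a' + h a a') ^ 2) =
      (∑ a ∈ S, ∑ a' ∈ S, (g a a') ^ 2) + 2 * (∑ a ∈ S, ∑ a' ∈ S, g a a' * h a a') +
        ∑ a ∈ S, ∑ a' ∈ S, (h a a') ^ 2 := by
  have : ∀ a a', (g a a' + h a a') ^ 2 = (g a a') ^ 2 + 2 * (g a a' * h a a') + (h a a') ^ 2 :=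
    fun a a' => by ring
  simp_rw [this, Finset.sum_add_distrib, Finset.mul_sum]

/-- Column monotonicity at a fixed row set (the PSD half of (P)). -/
theorem cols_mono (f : ℕ → ℕ → ℝ) (S T T' : Finset ℕ) (hT : T ⊆ T') :
    (∑ a ∈ S, ∑ a' ∈ S, (∑ b ∈ T, f a b * f a' b) ^ 2) ≤
      ∑ a ∈ S, ∑ a' ∈ S, (∑ b ∈ T', f a b * f a' b) ^ 2 := by
  have hU : T' = T ∪ (T' \ T) := (Finset.union_sdiff_of_subset hT).symm
  rw [hU]
  simp_rw [Finset.sum_union Finset.disjoint_sdiff]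
  rw [sq_sum_expand]
  have h1 := cross_nonneg f S T (T' \ T)
  have h2 : 0 ≤ ∑ a ∈ S, ∑ a' ∈ S, (∑ d ∈ T' \ T, f a d * f a' d) ^ 2 :=
    Finset.sum_nonneg (fun _ _ => Finset.sum_nonneg (fun _ _ => sq_nonneg _))
  linarith

/-- LEVER (P) of card `positivity-quarantine`, sorry-free. -/
theorem gramFourthMomentMonotone : GramFourthMomentMonotone := by
  intro f S S' T T' hS hT
  exact le_trans (rows_mono f S S' T hS) (cols_mono f S' T T' hT)

/-- Cross Gram block between two row sets is at most the mean of the two diagonal moments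
(`2 P₁ P₂ ≤ P₁² + P₂²` columnwise, after `cross_eq₂`/`cross_eq`). -/
theorem cross_rows_le (f : ℕ → ℕ → ℝ) (S₁ S₂ T : Finset ℕ) :
    2 * (∑ a ∈ S₁, ∑ a' ∈ S₂, (∑ b ∈ T, f a b * f a' b) ^ 2) ≤
      (∑ a ∈ S₁, ∑ a' ∈ S₁, (∑ b ∈ T, f a b * f a' b) ^ 2) +
        (∑ a ∈ S₂, ∑ a' ∈ S₂, (∑ b ∈ T, f a b * f a' b) ^ 2) := by
  have hsq : ∀ (S S' : Finset ℕ), (∑ a ∈ S, ∑ a' ∈ S', (∑ b ∈ T, f a b * f a' b) ^ 2) =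
      ∑ a ∈ S, ∑ a' ∈ S', (∑ b ∈ T, f a b * f a' b) * (∑ d ∈ T, f a d * f a' d) := by
    intro S S'
    apply Finset.sum_congr rfl; intro a _; apply Finset.sum_congr rfl; intro a' _; ring
  rw [hsq S₁ S₂, cross_eq₂ f S₁ S₂ T T, hsq S₁ S₁, cross_eq f S₁ T T, hsq S₂ S₂, cross_eq f S₂ T T,
    Finset.mul_sum, ← Finset.sum_add_distrib]
  apply Finset.sum_le_sum
  intro b _
  rw [Finset.mul_sum, ← Finset.sum_add_distrib]
  apply Finset.sum_le_sum
  intro d _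
  nlinarith [sq_nonneg ((∑ a ∈ S₁, f a b * f a d) - (∑ a' ∈ S₂, f a' b * f a' d))]

/-- LEVER (P') of card `rough-rows-descent`, sorry-free: `F(S₁ ⊔ S₂) ≤ 2 (F(S₁) + F(S₂))`. -/
theorem rowSplitBound : RowSplitBound := by
  intro f S₁ S₂ T hdisj
  rw [Finset.sum_union hdisj]
  simp_rw [Finset.sum_union hdisj]
  rw [Finset.sum_add_distrib, Finset.sum_add_distrib]
  have h12 := cross_rows_le f S₁ S₂ T
  have h21 := cross_rows_le f S₂ S₁ T
  linarith

end Summit.Parity.GeneralizedHardyLittlewood.Cruxes.DilatedTableChowla.Triage2
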